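import Mathlib.Tactic

/-!
# PercRepro — `num_ge`, PART 2: THE POLYNOMIAL INEQUALITIES AND THE RATIONAL CORES (night-1, gen 10; dossier §20)

The four termwise comparisons `dem(σ,j) ≤ ν(σ,j)` of RankLevelSetNumGe reduce, after the identities
`C(p−k−1,j)·(p−k) = C(p−k,j)·(p−k−j)` and `C(q+m+1,q)·(m+1) = C(q+m,q)·(q+m+1)`, to polynomial inequalities in the
natural numbers (`poly_I1` … `poly_I3'`, all needing `q ≤ 10`) and to denominator-clearing steps in `ℚ` (`coreB` …
`coreDq`).  Mathlib only.

* (I1) `σ = 1`, `j ≥ 2`: `(q+j+1+k(j+1))·a ≤ (a+j)(a+k−1)(j+1)`, `a = p − k − j ≥ q + 3 − k`;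
* (I2) `j = 1`, `σ ≥ 2`, `k < q`: `k·a(σ+1) + k(q+σ+1) ≤ (a+1)(p+q)(σ+1)`, `a = p − k − 1`;
* (I3) `(σ,j) = (1,1)`, `k < q`: `a(q+2) + 2ka + k(q+2) ≤ 2(a+1)(p+q)` — the binding case (`q ≤ 10` is sharp here).

Axioms: standard.
-/

namespace PercRepro

/-! ### The polynomial inequalities behind the four cases (`q ≤ 10`) -/

/-- (I1) for `σ = 1`, `2 ≤ j`, both charges present: `a = p − k − j`, `k = k' + 1`. -/
lemma poly_I1 (a j k q : ℕ) (hq : q ≤ 10) (hk1 : 1 ≤ k) (hkq : k ≤ q) (hj : 2 ≤ j) (ha : q + 3 ≤ a + k) :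
    (q + j + 1 + k * (j + 1)) * a + (a + j) * (j + 1) ≤ (a + j) * (a + k) * (j + 1) := by
  obtain ⟨k', rfl⟩ : ∃ k', k = k' + 1 := ⟨k - 1, by omega⟩
  have ha3 : 3 ≤ a := by omega
  rcases Nat.lt_or_ge a 4 with h4 | h4
  · have : a = 3 := by omega
    subst this
    have hk' : q ≤ k' + 1 := by omega
    nlinarith [Nat.mul_le_mul hj hj, Nat.mul_le_mul_left j hj]
  · nlinarith [Nat.mul_le_mul h4 hj, Nat.mul_le_mul_left a hj, Nat.mul_le_mul_left j h4,
      Nat.mul_le_mul_left k' hj, Nat.mul_le_mul_left (a * k') hj]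

/-- (I2) for `j = 1`, `2 ≤ σ`, `k < q`, both charges present: `a = p − k − 1 ≥ σ + 3`. -/
lemma poly_I2 (a s k q : ℕ) (hq : q ≤ 10) (hkq : k + 1 ≤ q) (hs : 2 ≤ s) (hsk : s ≤ k) (ha : s + 3 ≤ a) :
    k * a * (s + 1) + k * (q + s + 1) ≤ (a + 1) * (a + 1 + k + q) * (s + 1) := by
  nlinarith [Nat.mul_le_mul_left k hs, Nat.mul_le_mul_left a hs, Nat.mul_le_mul ha hs,
    Nat.mul_le_mul_left (k * s) ha, Nat.mul_le_mul_left q hs]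

/-- (I2′) for `j = 1`, `2 ≤ σ`, `k < q`, only the `j = 0` charge: `a = p − k − 1 ≥ σ + 2`. -/
lemma poly_I2' (a s k q : ℕ) (hq : q ≤ 10) (hkq : k + 1 ≤ q) (hs : 2 ≤ s) (hsk : s ≤ k) (ha : s + 2 ≤ a) :
    k * (q + s + 1) ≤ (a + 1) * (a + 1 + k + q) * (s + 1) := by
  nlinarith [Nat.mul_le_mul ha hs, Nat.mul_le_mul_left k hs, Nat.mul_le_mul_left q hs]

/-- (I3) for `(σ,j) = (1,1)`, `k < q`, `p − q ≥ 4`: `a = p − k − 1 ≥ 4`. -/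
lemma poly_I3 (a k q : ℕ) (hq : q ≤ 10) (hkq : k + 1 ≤ q) (ha : 4 ≤ a) :
    a * (q + 2) + 2 * k * a + k * (q + 2) ≤ 2 * (a + 1) * (a + 1 + k + q) := by
  nlinarith [Nat.mul_le_mul_left q ha, Nat.mul_le_mul_right k hq, Nat.mul_le_mul ha ha]

/-- (I3′) for `(σ,j) = (1,1)`, `k < q`, `p − q = 3`: `a = p − k − 1 ≥ 3`. -/
lemma poly_I3' (a k q : ℕ) (hq : q ≤ 10) (hkq : k + 1 ≤ q) (ha : 3 ≤ a) :
    a * (q + 2) + k * (q + 2) ≤ 2 * (a + 1) * (a + 1 + k + q) := by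
  nlinarith [Nat.mul_le_mul_left q ha, Nat.mul_le_mul_right k hq, Nat.mul_le_mul_left k ha]

/-! ### Rational cores: clearing the denominators -/

/-- Case (B), both charges: `B = C(p−k−1,j)`, `B′ = C(p−k,j)`, `X = C(q+j,q)`, `Y = C(q+j+1,q)`. -/
lemma coreB (B B' X Y k p q j : ℚ) (hB : 0 ≤ B) (hX : 0 < X) (hY : 0 < Y) (hk : 0 < k)
    (hj1 : 0 < j + 1) (hpkj : 0 < p - k - j) (hXY : Y * (j + 1) = X * (q + j + 1))
    (hBB : B * (p - k) = B' * (p - k - j))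
    (hI1 : (q + j + 1 + k * (j + 1)) * (p - k - j) ≤ (p - k) * (p - 1 - j) * (j + 1)) :
    k * B / X + k * k * B / Y ≤ k * B' * (p - 1 - j) / Y := by
  have hkey : B * Y + k * B * X ≤ B' * (p - 1 - j) * X := by
    refine le_of_mul_le_mul_right ?_ (mul_pos hj1 hpkj)
    calc (B * Y + k * B * X) * ((j + 1) * (p - k - j))
        = B * (Y * (j + 1)) * (p - k - j) + k * B * X * (j + 1) * (p - k - j) := by ring
      _ = B * (X * (q + j + 1)) * (p - k - j) + k * B * X * (j + 1) * (p - k - j) := by rw [hXY]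
      _ = B * X * ((q + j + 1 + k * (j + 1)) * (p - k - j)) := by ring
      _ ≤ B * X * ((p - k) * (p - 1 - j) * (j + 1)) :=
          mul_le_mul_of_nonneg_left hI1 (mul_nonneg hB hX.le)
      _ = (B * (p - k)) * (p - 1 - j) * X * (j + 1) := by ring
      _ = (B' * (p - k - j)) * (p - 1 - j) * X * (j + 1) := by rw [hBB]
      _ = B' * (p - 1 - j) * X * ((j + 1) * (p - k - j)) := by ring
  rw [div_add_div _ _ hX.ne' hY.ne', div_le_div_iff₀ (mul_pos hX hY) hY]
  have := mul_le_mul_of_nonneg_left hkey (mul_pos hk hY).le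
  calc (k * B * Y + X * (k * k * B)) * Y = k * Y * (B * Y + k * B * X) := by ring
    _ ≤ k * Y * (B' * (p - 1 - j) * X) := this
    _ = k * B' * (p - 1 - j) * (X * Y) := by ring

/-- Case (B), top charge only (`j = d − 2`, weight `q + 1`). -/
lemma coreB' (B B' X Y k q j : ℚ) (hB' : 0 ≤ B') (hBB' : B ≤ B') (hX : 0 < X) (hY : 0 < Y) (hk : 0 ≤ k)
    (hj1 : 0 < j + 1) (hXY : Y * (j + 1) = X * (q + j + 1)) (hjq : q + j + 1 ≤ (q + 1) * (j + 1)) :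
    k * B / X ≤ k * B' * (q + 1) / Y := by
  have hYX : Y ≤ X * (q + 1) := by
    refine le_of_mul_le_mul_right ?_ hj1
    rw [hXY]
    calc X * (q + j + 1) ≤ X * ((q + 1) * (j + 1)) := mul_le_mul_of_nonneg_left hjq hX.le
      _ = X * (q + 1) * (j + 1) := by ring
  rw [div_le_div_iff₀ hX hY]
  calc k * B * Y ≤ k * B' * Y := by
        apply mul_le_mul_of_nonneg_right (mul_le_mul_of_nonneg_left hBB' hk) hY.le
    _ ≤ k * B' * (X * (q + 1)) := mul_le_mul_of_nonneg_left hYX (mul_nonneg hk hB')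
    _ = k * B' * (q + 1) * X := by ring

/-- Case (C), `k < q`, both charges: `A = C(k,σ)`, `a = p − k − 1`, `n = p + q`, `s = σ`. -/
lemma coreC (A X Y a k n s q : ℚ) (hA : 0 ≤ A) (hX : 0 < X) (hY : 0 < Y) (hs : 0 < s + 1)
    (hXY : Y * (s + 1) = X * (q + s + 1))
    (hI2 : k * a * (s + 1) + k * (q + s + 1) ≤ (a + 1) * n * (s + 1)) :
    k * A * a / Y + k * A / X ≤ A * (a + 1) * n / Y := by
  have hkey : k * A * a * X + k * A * Y ≤ A * (a + 1) * n * X := by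
    refine le_of_mul_le_mul_right ?_ hs
    calc (k * A * a * X + k * A * Y) * (s + 1)
        = k * A * a * X * (s + 1) + k * A * (Y * (s + 1)) := by ring
      _ = k * A * a * X * (s + 1) + k * A * (X * (q + s + 1)) := by rw [hXY]
      _ = A * X * (k * a * (s + 1) + k * (q + s + 1)) := by ring
      _ ≤ A * X * ((a + 1) * n * (s + 1)) := mul_le_mul_of_nonneg_left hI2 (mul_nonneg hA hX.le)
      _ = A * (a + 1) * n * X * (s + 1) := by ring
  rw [div_add_div _ _ hY.ne' hX.ne', div_le_div_iff₀ (mul_pos hY hX) hY]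
  have := mul_le_mul_of_nonneg_left hkey hY.le
  calc (k * A * a * X + Y * (k * A)) * Y = Y * (k * A * a * X + k * A * Y) := by ring
    _ ≤ Y * (A * (a + 1) * n * X) := this
    _ = A * (a + 1) * n * (Y * X) := by ring

/-- Case (C), `k < q`, only the `j = 0` charge. -/
lemma coreC' (A X Y a k n s q : ℚ) (hA : 0 ≤ A) (hX : 0 < X) (hY : 0 < Y) (hs : 0 < s + 1)
    (hXY : Y * (s + 1) = X * (q + s + 1))
    (hI2 : k * (q + s + 1) ≤ (a + 1) * n * (s + 1)) :
    k * A / X ≤ A * (a + 1) * n / Y := by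
  rw [div_le_div_iff₀ hX hY]
  refine le_of_mul_le_mul_right ?_ hs
  calc k * A * Y * (s + 1) = k * A * (Y * (s + 1)) := by ring
    _ = k * A * (X * (q + s + 1)) := by rw [hXY]
    _ = A * X * (k * (q + s + 1)) := by ring
    _ ≤ A * X * ((a + 1) * n * (s + 1)) := mul_le_mul_of_nonneg_left hI2 (mul_nonneg hA hX.le)
    _ = A * (a + 1) * n * X * (s + 1) := by ring

/-- Case (C) and (D), `k = q`: `m̄ = X ≤ Y`; `k·a/Y + k/X ≤ (a+1)·n/X` once `k ≤ n`. -/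
lemma coreQ (A X Y a k n : ℚ) (hA : 0 ≤ A) (hX : 0 < X) (hXY : X ≤ Y) (hk : 0 ≤ k) (ha : 0 ≤ a)
    (hkn : k ≤ n) :
    k * A * a / Y + k * A / X ≤ A * (a + 1) * n / X := by
  have hY : 0 < Y := lt_of_lt_of_le hX hXY
  calc k * A * a / Y + k * A / X ≤ k * A * a / X + k * A / X := by
        gcongr
    _ = (k * A * (a + 1)) / X := by rw [← add_div]; ring
    _ ≤ (A * (a + 1) * n) / X := by
        apply div_le_div_of_nonneg_right _ hX.le
        calc k * A * (a + 1) = A * (a + 1) * k := by ring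
          _ ≤ A * (a + 1) * n := mul_le_mul_of_nonneg_left hkn (by positivity)

/-- Case (D) core, `k < q`, all three charges (`p − q ≥ 4`): `X = C(q+1,q)`, `Y = C(q+2,q)`, `a = p − k − 1`. -/
lemma coreD (X Y a k n q : ℚ) (hX : 0 < X) (hY : 0 < Y) (hXY : Y * (1 + 1) = X * (q + 1 + 1)) (hk : 0 < k)
    (ha : 0 ≤ a) (hI3 : a * (q + 2) + 2 * k * a + k * (q + 2) ≤ 2 * (a + 1) * n) :
    k * a / X + k * k * a / Y + k * k / X ≤ k * (a + 1) * n / Y := by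
  have hkey : a * Y + k * a * X + k * Y ≤ (a + 1) * n * X := by
    refine le_of_mul_le_mul_right ?_ (by norm_num : (0 : ℚ) < 2)
    calc (a * Y + k * a * X + k * Y) * 2 = a * (Y * (1 + 1)) + 2 * k * a * X + k * (Y * (1 + 1)) := by ring
      _ = a * (X * (q + 1 + 1)) + 2 * k * a * X + k * (X * (q + 1 + 1)) := by rw [hXY]
      _ = X * (a * (q + 2) + 2 * k * a + k * (q + 2)) := by ring
      _ ≤ X * (2 * (a + 1) * n) := mul_le_mul_of_nonneg_left hI3 hX.le
      _ = (a + 1) * n * X * 2 := by ring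
  have hL : k * a / X + k * k * a / Y + k * k / X = k * (a * Y + k * a * X + k * Y) / (X * Y) := by
    field_simp
  rw [hL, div_le_div_iff₀ (mul_pos hX hY) hY]
  have := mul_le_mul_of_nonneg_left hkey (mul_pos hk hY).le
  calc k * (a * Y + k * a * X + k * Y) * Y = k * Y * (a * Y + k * a * X + k * Y) := by ring
    _ ≤ k * Y * ((a + 1) * n * X) := this
    _ = k * (a + 1) * n * (X * Y) := by ring

/-- Case (D) core, `k < q`, two charges (`p − q = 3`). -/
lemma coreD' (X Y a k n q : ℚ) (hX : 0 < X) (hY : 0 < Y) (hXY : Y * (1 + 1) = X * (q + 1 + 1)) (hk : 0 < k)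
    (hI3 : a * (q + 2) + k * (q + 2) ≤ 2 * (a + 1) * n) :
    k * a / X + k * k / X ≤ k * (a + 1) * n / Y := by
  have hkey : a * Y + k * Y ≤ (a + 1) * n * X := by
    refine le_of_mul_le_mul_right ?_ (by norm_num : (0 : ℚ) < 2)
    calc (a * Y + k * Y) * 2 = a * (Y * (1 + 1)) + k * (Y * (1 + 1)) := by ring
      _ = a * (X * (q + 1 + 1)) + k * (X * (q + 1 + 1)) := by rw [hXY]
      _ = X * (a * (q + 2) + k * (q + 2)) := by ring
      _ ≤ X * (2 * (a + 1) * n) := mul_le_mul_of_nonneg_left hI3 hX.le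
      _ = (a + 1) * n * X * 2 := by ring
  rw [← add_div, div_le_div_iff₀ hX hY]
  have := mul_le_mul_of_nonneg_left hkey hk.le
  calc (k * a + k * k) * Y = k * (a * Y + k * Y) := by ring
    _ ≤ k * ((a + 1) * n * X) := this
    _ = k * (a + 1) * n * X := by ring

/-- Case (D) core, `k = q`: `m̄ = X ≤ Y`. -/
lemma coreDq (X Y a k n : ℚ) (hX : 0 < X) (hXY : X ≤ Y) (hk : 0 ≤ k) (ha : 0 ≤ a)
    (hkn : a * (k + 1) + k ≤ (a + 1) * n) :
    k * a / X + k * k * a / Y + k * k / X ≤ k * (a + 1) * n / X := by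
  have hY : 0 < Y := lt_of_lt_of_le hX hXY
  calc k * a / X + k * k * a / Y + k * k / X ≤ k * a / X + k * k * a / X + k * k / X := by
        gcongr
    _ = k * (a * (k + 1) + k) / X := by rw [← add_div, ← add_div]; ring
    _ ≤ k * ((a + 1) * n) / X := by
        apply div_le_div_of_nonneg_right _ hX.le
        exact mul_le_mul_of_nonneg_left hkn hk
    _ = k * (a + 1) * n / X := by ring


end PercRepro
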